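import Literature.NumberTheory.EllipticCurves.TwoVariablePadicLFunction
import Literature.NumberTheory.EllipticCurves.CuspFormLFunctionCriticalNonvanishingProofs
import Literature.NumberTheory.EllipticCurves.EisensteinNewformLevelRaisingDeligneSerreLiftProofs
import HarnessLib

/-!
# The Greenberg–Stevens / Kitagawa ratio interpolation — corrected statement, and its proof
# from the value–norm interpolation and the Hida members

Topic `Literature/NumberTheory/EllipticCurves`.

The named fact `Literature.NumberTheory.EllipticCurves.greenbergStevens_kitagawa_ratio_interpolation`
(`GreenbergStevensRatioInterpolation.lean`, relocated by the gate from a Summits proposal) is MIS-STATED.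
It evaluates ONE bounded two-variable series `F(X, Y)` (the one whose weight-`2` row is the
Mazur–Swinnerton-Dyer `p`-adic `L`-function `L_p(f_E, α; T) = ∫_{ℤ_p^×} (1+T)^{ℓ(x)} dμ`, `⟨x⟩ = γ^{ℓ(x)}`,
`γ = 1 + p`) at the cyclotomic points `Y = y_σ := γ^{σ-1} - 1` for ALL odd `σ = s, j` below `k/2`, and
asserts that the values interpolate the UNTWISTED critical values `L(g_k, σ)` with the Euler-type factor
`E(σ) = (1 - p^{σ-1}/α_k)(1 - p^{k-1-σ}/α_k)`.  But `(1+Y)^{ℓ(x)}` at `Y = y_σ` is the character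
`x ↦ ⟨x⟩^{σ-1} = x^{σ-1} ω^{1-σ}(x)` of `ℤ_p^×` (`ω` the Teichmüller character), so by the very definition
of the one- and two-variable functions (Delbourgo 2008, §2.1, `𝐋_p(f, ψ, s) := ∫ ψ^{-1}(x) ⟨x⟩^{s-1} dμ_{f,α}`,
PDF p. 41; Def. 4.12, `𝐋^{GS}_p(𝐟, ψ, w, s) := ∫ ψ^{-1}(x) ⟨x⟩^{s-1} ε(y/x) ⟨y⟩^{w-k₀}/⟨x⟩^{w-k₀} dμ_𝐟`)
and by the interpolation theorems as printed (Mazur–Tate–Teitelbaum, Delbourgo Thm. 2.2: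
`∫ ψ^{-1}(x) x^j dμ_{f,α} = j! p^{nj} α^{-n} (1 - ψ^{-1}(p)p^j/α)(1 - ψ(p)ε(p)p^{k-2-j}/α) G(ψ^{-1}) ·
L(f, ψ, j+1)/((2πi)^j Ω^±)` for `ψ` of conductor `p^n`; Greenberg–Stevens 1993, Thm. 5.15 / Kitagawa 1994 =
Delbourgo Thm. 4.11 and p. 100), the value `F(x_k, y_σ)` is — up to the `𝕀`-adic period — the
`ψ = ω^{σ-1}`-TWISTED quantity `(σ-1)! p^{σ-1} α_k^{-1} G(ω^{1-σ}) L(g_k, ω^{σ-1}, σ)/((2πi)^{σ-1} Ω⁺)`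
whenever `(p - 1) ∤ (σ - 1)` (then `ω^{σ-1}` has conductor `p`, `ψ(p) = 0`, and no Euler factor `E(σ)`
appears), and it is the untwisted `(σ-1)! E(σ) L(g_k, σ)/((2πi)^{σ-1} Ω⁺)` exactly when `(p-1) ∣ (σ-1)`.
The ratio form therefore compares quantities living on DIFFERENT Teichmüller branches as soon as
`s ≢ 1` or `j ≢ 1 (mod p-1)` (e.g. `s = 1`, `j = 3`, admissible for every `p ≥ 5` once `k ≥ 8`), and for
such `(s, j)` it is not a consequence of [GS, Ki]; indeed it is false in general: letting `k → 2`
`p`-adically in `k ≡ 2 (mod p-1)` it would force `‖∫_{ℤ_p^×} ⟨x⟩² dμ_{f_E,α}‖ = ‖∫_{ℤ_p^×} x² dμ_{f_E,α}‖`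
for every admissible `(E, p)` with `L(E,1) ≠ 0`, whereas for `E = 17a1`, `p = 5` (good ordinary,
`a_5 = -2`, `a_5² ≢ 1`, `ρ̄_{E,5}` surjective, (Br) holds, `L(E,1)/Ω⁺ = 1/4` a `5`-unit) the left side is a
unit (`≡ (1 - α^{-1})² L(E,1)/Ω⁺ mod 5`) while the right side is
`≡ α^{-1} Σ_{a mod 5} χ₅(a) [a/5]⁺ = α^{-1} G(χ₅) L(E, χ₅, 1)/Ω⁺ = 0 (mod 5)` because the quadratic twist
`E ⊗ χ₅` (conductor `425`) has root number `χ₅(17) w(E) = -1`.  (Sketch recorded in the seat's notes; no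
Lean refutation is claimed, the objects being uncomputable in the tree.)

This file states the CORRECTED ratio form — the statement of the original VERBATIM except that the edge
ratio identity is asserted only for `s ≡ j ≡ 1 (mod p - 1)` (two inserted hypotheses `(p - 1) ∣ (s - 1)`,
`(p - 1) ∣ (j - 1)`: the trivial Teichmüller branch, exactly the restriction `(p - 1) ∣ (n - 1)` of the
tree's value–norm form `greenbergStevens_kitagawa_twoVariable_interpolation`) — as the conclusion of the
THEOREM `Literature.NumberTheory.EllipticCurves.greenbergStevens_kitagawa_ratio_interpolation_corrected`,
and PROVES it from the two named facts of the tree that carry the actual content (taken as hypotheses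
`(hGS : …) (hHida : …)`; THEOREMS ONLY — no definition, no new named fact, D-0026):

* `Literature.NumberTheory.EllipticCurves.greenbergStevens_kitagawa_twoVariable_interpolation`
  (`TwoVariablePadicLFunction.lean`; Greenberg–Stevens 1993, Thm. 5.15; Kitagawa 1994, Thm. 1.1 and
  Prop. 5.12; Delbourgo 2008, Thm. 4.11, Def. 4.12, p. 100) — the two-variable series `F ∈ ℤ_p⟦X, Y⟧`,
  its weight-`2` row, and the value–norm interpolation
  `‖F(x_k, y_n)‖ = ‖Ω_k‖ · ‖(1 - p^{n-1}/α)(1 - p^{k-1-n}/α)‖ · ‖ι(iⁿ Λ(g, n)/ω)‖` at odd `n < k/2`,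
  `(p-1) ∣ (n-1)`, for every branch member `(g, ι)`;
* `Literature.NumberTheory.EllipticCurves.hida_exists_congruent_ordinary_newform`
  (`HidaFamilyMembers.lean`; Hida 1986) — existence of the member `g_k` in every weight `k > 2`,
  `k ≡ 2 (mod p-1)`.

The derivation is elementary: both Euler-type factors have norm `1` (`n = 1`: `‖1 - α^{-1}‖ = ‖α - 1‖ = 1` because
`‖α - a_p(E)‖ < 1` and `p ∤ a_p(E) - 1`, from `p ∤ a_p(E)² - 1`; `n ≥ 3` and the second factor:
`‖p^m/α‖ < 1`, `m ≥ 1`), the denominators `Λ(g, j)` are non-zero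
(`IsNewform0.completedLValue_ne_zero_of_two_mul_add_two_lt`: `(p-1) ∣ (k-2), (j-1)` and `2j < k` give
`k - 2j ≥ p - 1 ≥ 4`, so `2j + 2 < k`), `Λ(g,s)/Λ(g,j) = (iˢΛ(g,s)/ω)/(iʲΛ(g,j)/ω) · iʲ/iˢ` with
`iʲ/iˢ = ±1`, and the period `Ω_k` — one per `(k, g, ι)` — cancels in the ratio.  The double `tsum` over
`ℕ × ℕ` of the ratio form is the tree's `padicEval₂` (reindexing `(Fin 2 →₀ ℕ) ≃ ℕ × ℕ`), and
`cyclotomicGenerator p = 1 + p` for odd `p`.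

So the corrected ratio form carries no literature debt of its own: it is exactly as hard as the two named
facts above, and becomes unconditional the moment their `_holds` land.  Consumers of the misstated fact
(route `TangentCone`, crux `EdgeDecay`, line `lambda-layer-one`) should take those two facts as hypotheses and
apply this theorem; note that it only serves edge ratios `Λ(g_k,s)/Λ(g_k,j)` with `s ≡ j ≡ 1 (mod p-1)` — the
other residue classes need the other Teichmüller branches of the two-variable `L`-function (TODO below).

## References
* R. Greenberg, G. Stevens, *p-adic L-functions and p-adic periods of modular forms*, Invent. Math. 111
  (1993) 407–447, Thm. 5.15. [GreenbergStevens1993]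
* K. Kitagawa, *On standard p-adic L-functions of families of elliptic cusp forms*, Contemp. Math. 165
  (1994) 81–110, Thm. 1.1, Prop. 5.12. [Kitagawa1994]
* D. Delbourgo, *Elliptic Curves and Big Galois Representations*, LMS LNS 356, CUP 2008, §2.1 (Thm. 2.2 and
  the definition of `𝐋_p(f, ψ, s)`, PDF p. 41), Thm. 4.11, Def. 4.12, p. 100. [Delbourgo2008]
* B. Mazur, J. Tate, J. Teitelbaum, *On p-adic analogues of the conjectures of Birch and Swinnerton-Dyer*,
  Invent. Math. 84 (1986), §I.13–I.14. [MazurTateTeitelbaum1986Invent]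
* H. Hida, *Galois representations into GL₂(ℤ_p[[X]]) attached to ordinary cusp forms*, Invent. Math. 85
  (1986). [Hida1986]
-/

noncomputable section

namespace Literature.NumberTheory.EllipticCurves

open scoped Classical
open Filter Topology
open Literature.NumberTheory.EllipticCurves.ModularForms

/-! ### Auxiliary lemmas -/

section Aux

variable {p : ℕ} [Fact p.Prime]

/-- The double `tsum` over `ℕ × ℕ` of the ratio form is the tree's `padicEval₂` (reindexing along
`(Fin 2 →₀ ℕ) ≃ ℕ × ℕ`). [folklore] -/
theorem tsum_coeff_mul_pow_mul_pow_eq_padicEval₂ (F : MvPowerSeries (Fin 2) ℚ_[p]) (u v : ℚ_[p]) :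
    ∑' n : ℕ × ℕ, MvPowerSeries.coeff (Finsupp.single 0 n.1 + Finsupp.single 1 n.2) F * u ^ n.1 * v ^ n.2 =
      padicEval₂ F u v := by
  let e : (Fin 2 →₀ ℕ) ≃ ℕ × ℕ := Finsupp.equivFunOnFinite.trans (finTwoArrowEquiv ℕ)
  have he : ∀ d : Fin 2 →₀ ℕ, Finsupp.single 0 (e d).1 + Finsupp.single 1 (e d).2 = d := by
    intro d
    ext i
    fin_cases i <;> simp [e]
  rw [padicEval₂, ← e.tsum_eq]
  refine tsum_congr fun d => ?_
  rw [he d]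
  change MvPowerSeries.coeff d F * u ^ (d 0) * v ^ (d 1) = _
  ring

/-- `γ = cyclotomicGenerator p = 1 + p` in `ℚ_p` for odd `p`. [folklore] -/
theorem cast_cyclotomicGenerator_of_ne_two (hp2 : p ≠ 2) :
    ((cyclotomicGenerator p : ℕ) : ℚ_[p]) = 1 + (p : ℚ_[p]) := by
  simp [cyclotomicGenerator, cyclotomicExponent, hp2]

/-- `‖1 - x‖ = 1` for `‖x‖ < 1` in `ℚ̄_p` (ultrametric). [folklore] -/
theorem norm_one_sub_eq_one_of_norm_lt_one {x : PadicAlgCl p} (hx : ‖x‖ < 1) : ‖1 - x‖ = 1 := by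
  have h : ‖(1 : PadicAlgCl p)‖ ≠ ‖-x‖ := by rw [norm_one, norm_neg]; exact hx.ne'
  rw [sub_eq_add_neg, IsUltrametricDist.norm_add_eq_max_of_norm_ne_norm h, norm_one, norm_neg,
    max_eq_left hx.le]

/-- `‖1 - p^m/α‖ = 1` in `ℚ̄_p` for `‖α‖ = 1` and `m ≥ 1` (`‖p^m/α‖ = p^{-m} < 1`). [folklore] -/
theorem norm_one_sub_prime_pow_div_eq_one {α : PadicAlgCl p} (hα : ‖α‖ = 1) {m : ℕ} (hm : 1 ≤ m) :
    ‖1 - (p : PadicAlgCl p) ^ m / α‖ = 1 := by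
  refine norm_one_sub_eq_one_of_norm_lt_one ?_
  have hp : ‖(p : PadicAlgCl p)‖ < 1 := by
    rw [← map_natCast (algebraMap ℚ_[p] (PadicAlgCl p)) p, PadicAlgCl.norm_extends]
    exact Padic.norm_p_lt_one
  rw [norm_div, hα, div_one, norm_pow]
  exact pow_lt_one₀ (norm_nonneg _) hp (by omega)

/-- `‖1 - 1/α‖ = 1` when `α ≡ a (mod 𝔪)` for an integer `a` with `p ∤ a - 1`. [folklore] -/
theorem norm_one_sub_inv_eq_one {α : PadicAlgCl p} (hα : ‖α‖ = 1) {a : ℤ}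
    (hcong : ‖α - (a : PadicAlgCl p)‖ < 1) (ha : ¬ (p : ℤ) ∣ a - 1) :
    ‖1 - 1 / α‖ = 1 := by
  have hα0 : α ≠ 0 := norm_pos_iff.mp (by rw [hα]; exact one_pos)
  have h1 : ‖((a : PadicAlgCl p)) - 1‖ = 1 := by
    have := DeligneSerreLift.norm_intCast_eq_one_of_not_dvd (p := p) ha
    push_cast at this
    exact this
  have hne : ‖α - (a : PadicAlgCl p)‖ ≠ ‖((a : PadicAlgCl p)) - 1‖ := by
    rw [h1]; exact hcong.ne
  have h2 : ‖α - 1‖ = 1 := by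
    have h := IsUltrametricDist.norm_add_eq_max_of_norm_ne_norm hne
    rw [show α - (a : PadicAlgCl p) + ((a : PadicAlgCl p) - 1) = α - 1 by ring, h1,
      max_eq_right hcong.le] at h
    exact h
  rw [show (1 : PadicAlgCl p) - 1 / α = (α - 1) / α by field_simp, norm_div, h2, hα, div_one]

/-- The Euler-type factor of the value–norm interpolation has norm `1` at odd `n` with `2n < k`, for a
unit root `α ≡ a_p(E)` with `p ∤ a_p(E)² - 1`. [folklore] -/
theorem norm_eulerFactor_eq_one {α : PadicAlgCl p} (hα : ‖α‖ = 1) {a : ℤ}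
    (hcong : ‖α - (a : PadicAlgCl p)‖ < 1) (ha : ¬ (p : ℤ) ∣ a ^ 2 - 1) {k : ℤ} {n : ℕ}
    (hn : Odd n) (hnk : 2 * (n : ℤ) < k) :
    ‖(1 - (p : PadicAlgCl p) ^ (n - 1) / α) * (1 - (p : PadicAlgCl p) ^ ((k - 1).toNat - n) / α)‖ = 1 := by
  have hn1 : 1 ≤ n := hn.pos
  rw [norm_mul, norm_one_sub_prime_pow_div_eq_one hα (m := (k - 1).toNat - n) (by omega), mul_one]
  rcases Nat.eq_or_lt_of_le hn1 with h | h
  · -- `n = 1`: `‖1 - α⁻¹‖ = 1`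
    subst h
    have ha1 : ¬ (p : ℤ) ∣ a - 1 := fun h ↦ ha (by
      rw [show a ^ 2 - 1 = (a - 1) * (a + 1) by ring]
      exact h.mul_right _)
    simpa using norm_one_sub_inv_eq_one hα hcong ha1
  · exact norm_one_sub_prime_pow_div_eq_one hα (by omega)

end Aux

/-! ### The corrected ratio form, from the value–norm form and the Hida members -/

/-- **Greenberg–Stevens / Kitagawa two-variable interpolation on the Hida branch of an elliptic curve,
RATIO form, on the trivial Teichmüller branch** — the CORRECTED form of the misstated named fact
`greenbergStevens_kitagawa_ratio_interpolation`, proved from the tree's value–norm form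
`greenbergStevens_kitagawa_twoVariable_interpolation` and Hida members `hida_exists_congruent_ordinary_newform`
taken as hypotheses (same sources: Greenberg–Stevens 1993, Thm. 5.15;
Kitagawa 1994; Delbourgo 2008, Thm. 4.11, Def. 4.12 and p. 100, with §2.1, Thm. 2.2 for the one-variable
interpolation).  Setting and conclusion are those of the original verbatim — `W` globally minimal of
conductor `N`, `p ≥ 5` good ordinary with `a_p(E)² ≢ 1 (mod p)`, surjective mod-`p` representation, the
isolation hypothesis (Br), `f` the newform of `W`; a bounded double series `F = Σ F_{ij} Xⁱ Yʲ` with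
`F(0, Y) = c · L_p(f, α_E; Y)`, `c ≠ 0` (`padicLCoeff`, `unitRoot`), and in every weight `k > 2`,
`k ≡ 2 (mod p-1)`, a `p`-ordinary newform `g ∈ S_k(Γ₀(N))` congruent to `E` with a `p`-adic embedding `ι`
of its coefficient field such that the edge ratios `R = Λ(g,s)/Λ(g,j)`
(`Λ(g,σ) = ∫₀^∞ t^{σ-1} g(it) dt`) lie in `K_g` and satisfy `‖ι R‖ · ‖F(x_k, y_j)‖ = ‖F(x_k, y_s)‖`,
`x_k = γ^{k-2} - 1`, `y_σ = γ^{σ-1} - 1`, `γ = cyclotomicGenerator p = 1 + p` — EXCEPT that the identity is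
asserted only for odd `s, j` (`2s < k`, `3 ≤ j`, `2j < k`) with `(p - 1) ∣ (s - 1)` and `(p - 1) ∣ (j - 1)`.
Discrepancy with the original: `F(x_k, γ^{σ-1} - 1) = ∫ ⟨x⟩^{σ-1} ⋯ dμ` is the `⟨x⟩^{σ-1} = x^{σ-1}ω^{1-σ}`
moment (Delbourgo Def. 4.12 / §2.1), which by Thm. 4.11 / Thm. 2.2 (character `ψ = ω^{σ-1}`, conductor
`p` unless `(p-1) ∣ (σ-1)`) interpolates the `ω^{σ-1}`-twisted value
`(σ-1)! p^{σ-1} α^{-1} G(ω^{1-σ}) L(g_k, ω^{σ-1}, σ)/((2πi)^{σ-1}Ω⁺)`, not `E(σ) L(g_k, σ)`; the original's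
docstring applies Thm. 4.11 with `ψ = 𝟙` at every `σ`, which is only legitimate for `σ ≡ 1 (mod p-1)`
(its factor `N^{σ-1}` is also spurious — Delbourgo's `M^j` has `M = 1` here — but harmless for norms).  On
the trivial branch both `F(x_k, y_s)` and `F(x_k, y_j)` are untwisted `+`-period values
(`Per⁺_{𝕀,λ_{P_k}} × E(σ)(σ-1)! L(g_k,σ)/((2πi)^{σ-1}Ω⁺_{g_k})`, p. 100 with Thm. 2.2, `ψ = 𝟙`), the
period and `Ω⁺` cancel, `‖E(σ)‖ = 1`, and the displayed norm identity results.  Proof: take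
`F_{ij} = [X₀ⁱX₁ʲ] F`, `M = 1` (`F` is `ℤ_p`-integral), the weight-`2` row from the weight-`2` clause of the
value–norm form, the members from Hida, and for `s ≡ j ≡ 1 (mod p-1)` divide the two value–norm identities:
the Euler-type factors have norm `1` (`norm_eulerFactor_eq_one`), `Λ(g, j) ≠ 0`
(`IsNewform0.completedLValue_ne_zero_of_two_mul_add_two_lt`, as `2j + 2 < k`),
`Λ(g,s)/Λ(g,j) = (iΛ(g,s)/ω)/(iΛ(g,j)/ω) ∈ K_g`, and the period `Ω_k` cancels.
-- TODO(general form): the other Teichmüller branches `F^{(c)}(X, Y) = ∫ ω^c(x)(1+X)^{ℓ(y/x)}(1+Y)^{ℓ(x)} dμ_𝐟`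
-- (`c` even), which interpolate `L(g_k, σ)` for `σ ≡ 1 + c (mod p-1)`; and Delbourgo Thm. 4.11 in full
-- (all `ψ`, all `0 ≤ j ≤ k-2`, values rather than norms, any primitive branch `𝕀`).
[cite: GreenbergStevens1993, Thm 5.15] [cite: Kitagawa1994, Thm 1.1 and Prop 5.12]
[cite: Delbourgo2008, Thm 2.2 (PDF p. 41), Thm 4.11, Def. 4.12 and p. 100]
-/
theorem greenbergStevens_kitagawa_ratio_interpolation_corrected
    (hGS : greenbergStevens_kitagawa_twoVariable_interpolation)
    (hHida : hida_exists_congruent_ordinary_newform) :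
    ∀ (W : WeierstrassCurve ℚ) [W.IsElliptic] [W.IsGloballyMinimal] (_ : NeZero (W.conductorNorm ℤ)) (p : ℕ) [Fact p.Prime], 5 ≤ p → W.HasGoodReductionAtPrime p → ¬ (p : ℤ) ∣ W.frobeniusTrace p → ¬ (p : ℤ) ∣ (W.frobeniusTrace p) ^ 2 - 1 → W.HasSurjectiveModNGaloisRep p → (∀ (M : ℕ) (_ : NeZero M) (g : CuspForm (CongruenceSubgroup.Gamma0 M) 2) (ι : Literature.NumberTheory.EllipticCurves.ModularForms.coeffField g →+* PadicAlgCl p), M ∣ W.conductorNorm ℤ * p → Literature.NumberTheory.EllipticCurves.ModularForms.IsNewform0 g → ‖ι ⟨(UpperHalfPlane.qExpansion 1 ⇑g).coeff p, Literature.NumberTheory.EllipticCurves.ModularForms.coeff_mem_coeffField g p⟩‖ = 1 → (∀ ℓ : ℕ, ℓ.Prime → ¬ ℓ ∣ W.conductorNorm ℤ * p → ‖ι ⟨(UpperHalfPlane.qExpansion 1 ⇑g).coeff ℓ, Literature.NumberTheory.EllipticCurves.ModularForms.coeff_mem_coeffField g ℓ⟩ - ((W.frobeniusTrace ℓ : ℤ)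 : PadicAlgCl p)‖ < 1) → M = W.conductorNorm ℤ ∧ ∀ n : ℕ, (UpperHalfPlane.qExpansion 1 ⇑g).coeff n = ((W.LFunction n : ℤ) : ℂ)) → ∀ (f : CuspForm (CongruenceSubgroup.Gamma0 (W.conductorNorm ℤ)) 2), Literature.NumberTheory.EllipticCurves.ModularForms.IsNewformOf W f → ∃ (F : ℕ → ℕ → ℚ_[p]) (M : ℝ) (c : ℚ_[p]), c ≠ 0 ∧ (∀ i j : ℕ, ‖F i j‖ ≤ M) ∧ (∀ j : ℕ, F 0 j = c * Literature.NumberTheory.EllipticCurves.padicLCoeff f (Literature.NumberTheory.EllipticCurves.unitRoot W p : ℚ_[p]) j) ∧ ∀ (k : ℤ), 2 < k → ((p : ℤ) - 1) ∣ (k - 2) → ∃ (g : CuspForm (CongruenceSubgroup.Gamma0 (W.conductorNorm ℤ)) k) (ι : Literature.NumberTheory.EllipticCurves.ModularForms.coeffField g →+* PadicAlgCl p), Literature.NumberTheory.EllipticCurves.ModularForms.IsNewform0 g ∧ ‖ι ⟨(UpperHalfPlane.qExpansion 1 ⇑g).coeff p, Literature.NumberTheory.EllipticCurves.ModularForms.coeff_mem_coeffField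 g p⟩‖ = 1 ∧ (∀ ℓ : ℕ, ℓ.Prime → ¬ ℓ ∣ W.conductorNorm ℤ * p → ‖ι ⟨(UpperHalfPlane.qExpansion 1 ⇑g).coeff ℓ, Literature.NumberTheory.EllipticCurves.ModularForms.coeff_mem_coeffField g ℓ⟩ - ((W.frobeniusTrace ℓ : ℤ) : PadicAlgCl p)‖ < 1) ∧ ∀ (s j : ℕ), Odd s → Odd j → 2 * (s : ℤ) < k → 3 ≤ j → 2 * (j : ℤ) < k → (p - 1) ∣ (s - 1) → (p - 1) ∣ (j - 1) → ∃ hR : (∫ t in Set.Ioi (0 : ℝ), ((t : ℂ) ^ (s - 1)) * g (UpperHalfPlane.ofComplex ((t : ℂ) * Complex.I))) / (∫ t in Set.Ioi (0 : ℝ), ((t : ℂ) ^ (j - 1)) * g (UpperHalfPlane.ofComplex ((t : ℂ) * Complex.I))) ∈ Literature.NumberTheory.EllipticCurves.ModularForms.coeffField g, ‖ι ⟨_, hR⟩‖ * ‖∑' n : ℕ × ℕ, F n.1 n.2 * (((Literature.NumberTheory.EllipticCurves.cyclotomicGenerator p : ℕ) : ℚ_[p]) ^ (k - 2).toNat - 1)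 ^ n.1 * (((Literature.NumberTheory.EllipticCurves.cyclotomicGenerator p : ℕ) : ℚ_[p]) ^ (j - 1) - 1) ^ n.2‖ = ‖∑' n : ℕ × ℕ, F n.1 n.2 * (((Literature.NumberTheory.EllipticCurves.cyclotomicGenerator p : ℕ) : ℚ_[p]) ^ (k - 2).toNat - 1) ^ n.1 * (((Literature.NumberTheory.EllipticCurves.cyclotomicGenerator p : ℕ) : ℚ_[p]) ^ (s - 1) - 1) ^ n.2‖ := by
  intro W _ _ hN p _ hp5 hgood hord hna hsurj hBr f hf
  haveI := hN
  have hp : p.Prime := Fact.out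
  have hp2 : p ≠ 2 := by omega
  -- the two-variable object of Greenberg–Stevens / Kitagawa (value–norm form)
  obtain ⟨F, hFint, hwt2, hinterp⟩ := hGS W hN p hp5 hgood hord hsurj hBr
  obtain ⟨c, hc, hcF⟩ := hwt2 f hf
  refine ⟨fun i j ↦ MvPowerSeries.coeff (Finsupp.single 0 i + Finsupp.single 1 j) F, 1, c, hc,
    fun i j ↦ hFint _, fun j ↦ ?_, fun k hk hpk ↦ ?_⟩
  · -- the weight-`2` row
    simp only [Finsupp.single_zero, zero_add]
    rw [hcF j, coeff_padicLFunction]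
  -- the weight-`k` member (Hida) and its interpolation data
  obtain ⟨g, ι, hgnew, hgord, hgcong⟩ := hHida W hN p hp5 hgood hord k hk hpk
  obtain ⟨Ω, α, ω, hΩ, hω, hαnorm, -, hαcong, hn⟩ := hinterp k g ι hk hpk hgnew hgord hgcong
  refine ⟨g, ι, hgnew, hgord, hgcong, fun s j hs hj hsk hj3 hjk hps hpj ↦ ?_⟩
  have hs0 : 0 < s := hs.pos
  have hj0 : 0 < j := by omega
  obtain ⟨hmems, heqs⟩ := hn s hs0 hsk hs hps
  obtain ⟨hmemj, heqj⟩ := hn j hj0 hjk hj hpj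
  -- rewrite the double sums as `padicEval₂` at the points of the value–norm form
  have hγ := cast_cyclotomicGenerator_of_ne_two (p := p) hp2
  have hx : (1 + (p : ℚ_[p])) ^ (k - 2).toNat = (1 + (p : ℚ_[p])) ^ (k - 2) := by
    rw [← zpow_natCast, Int.toNat_of_nonneg (by omega)]
  simp only [tsum_coeff_mul_pow_mul_pow_eq_padicEval₂, hγ, hx]
  -- non-vanishing of the denominator `Λ(g, j)`: `2j + 2 < k`
  have h2j : 2 * (j : ℤ) + 2 < k := by
    have hpj' : ((p : ℤ) - 1) ∣ ((j : ℤ) - 1) := by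
      have h := Int.natCast_dvd_natCast.mpr hpj
      rwa [Nat.cast_sub hp.one_le, Nat.cast_sub (by omega : 1 ≤ j)] at h
    have hdvd : ((p : ℤ) - 1) ∣ (k - 2 * j) := by
      have := hpk.sub (hpj'.mul_left 2)
      rwa [show k - 2 - 2 * ((j : ℤ) - 1) = k - 2 * j by ring] at this
    have hle := Int.le_of_dvd (by omega) hdvd
    omega
  have hΛj : completedLValue g j ≠ 0 := hgnew.completedLValue_ne_zero_of_two_mul_add_two_lt hj0 h2j
  -- the algebraic parts `iⁿ Λ(g,n)/ω` and `i Λ(g,n)/ω`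
  obtain ⟨a, rfl⟩ := hs
  obtain ⟨b, rfl⟩ := hj
  have hIa : Complex.I ^ (2 * a + 1) = (-1) ^ a * Complex.I := by
    rw [pow_succ, pow_mul, Complex.I_sq]
  have hIb : Complex.I ^ (2 * b + 1) = (-1) ^ b * Complex.I := by
    rw [pow_succ, pow_mul, Complex.I_sq]
  have hsgn : ∀ m : ℕ, ((-1 : ℂ) ^ m) ∈ coeffField g := fun m ↦ pow_mem (neg_mem (one_mem (coeffField g))) m
  -- `Cn := i Λ(g,n)/ω ∈ K`
  have hCs : Complex.I * completedLValue g (2 * a + 1) / ω ∈ coeffField g := by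
    have h := mul_mem (hsgn a) hmems
    rwa [hIa, show (-1 : ℂ) ^ a * ((-1) ^ a * Complex.I * completedLValue g (2 * a + 1) / ω) =
      ((-1) ^ a * (-1) ^ a) * (Complex.I * completedLValue g (2 * a + 1) / ω) by ring,
      ← pow_add, ← two_mul, pow_mul, neg_one_sq, one_pow, one_mul] at h
  have hCj : Complex.I * completedLValue g (2 * b + 1) / ω ∈ coeffField g := by
    have h := mul_mem (hsgn b) hmemj
    rwa [hIb, show (-1 : ℂ) ^ b * ((-1) ^ b * Complex.I * completedLValue g (2 * b + 1) / ω) =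
      ((-1) ^ b * (-1) ^ b) * (Complex.I * completedLValue g (2 * b + 1) / ω) by ring,
      ← pow_add, ← two_mul, pow_mul, neg_one_sq, one_pow, one_mul] at h
  have hCj0 : Complex.I * completedLValue g (2 * b + 1) / ω ≠ 0 :=
    div_ne_zero (mul_ne_zero Complex.I_ne_zero hΛj) hω
  -- the ratio
  have hRq : completedLValue g (2 * a + 1) / completedLValue g (2 * b + 1) =
      (Complex.I * completedLValue g (2 * a + 1) / ω) / (Complex.I * completedLValue g (2 * b + 1) / ω) := by
    field_simp
  have hR : completedLValue g (2 * a + 1) / completedLValue g (2 * b + 1) ∈ coeffField g := by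
    rw [hRq]; exact div_mem hCs hCj
  refine ⟨hR, ?_⟩
  -- norms: `‖ι R‖ = ‖ι As‖ / ‖ι Aj‖`
  have hιinj : Function.Injective ι := ι.injective
  have hquot : (⟨_, hR⟩ : coeffField g) = (⟨_, hCs⟩ : coeffField g) / ⟨_, hCj⟩ := Subtype.ext (by push_cast; exact hRq)
  have hAs : (⟨_, hmems⟩ : coeffField g) = (⟨(-1 : ℂ) ^ a, hsgn a⟩ : coeffField g) * ⟨_, hCs⟩ :=
    Subtype.ext (by push_cast; rw [hIa]; ring)
  have hAj : (⟨_, hmemj⟩ : coeffField g) = (⟨(-1 : ℂ) ^ b, hsgn b⟩ : coeffField g) * ⟨_, hCj⟩ :=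
    Subtype.ext (by push_cast; rw [hIb]; ring)
  have hnegone : ∀ m : ℕ, ‖ι ⟨(-1 : ℂ) ^ m, hsgn m⟩‖ = 1 := by
    intro m
    have : (⟨(-1 : ℂ) ^ m, hsgn m⟩ : coeffField g) = (-1) ^ m := Subtype.ext (by push_cast; rfl)
    rw [this, map_pow, map_neg, map_one, norm_pow, norm_neg, norm_one, one_pow]
  have hnAs : ‖ι ⟨_, hmems⟩‖ = ‖ι ⟨_, hCs⟩‖ := by
    rw [hAs, map_mul, norm_mul, hnegone, one_mul]
  have hnAj : ‖ι ⟨_, hmemj⟩‖ = ‖ι ⟨_, hCj⟩‖ := by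
    rw [hAj, map_mul, norm_mul, hnegone, one_mul]
  have hιCj : ‖ι ⟨_, hCj⟩‖ ≠ 0 := by
    rw [norm_ne_zero_iff]
    intro h0
    have : (⟨_, hCj⟩ : coeffField g) = 0 := hιinj (by rw [h0, map_zero])
    exact hCj0 (congrArg Subtype.val this)
  -- the Euler-type factors have norm one
  have hes := norm_eulerFactor_eq_one (k := k) hαnorm hαcong hna (odd_two_mul_add_one a) hsk
  have hej := norm_eulerFactor_eq_one (k := k) hαnorm hαcong hna (odd_two_mul_add_one b) hjk
  show ‖ι (⟨completedLValue g (2 * a + 1) / completedLValue g (2 * b + 1), hR⟩ : coeffField g)‖ *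
      ‖padicEval₂ F ((1 + (p : ℚ_[p])) ^ (k - 2) - 1) ((1 + (p : ℚ_[p])) ^ (2 * b + 1 - 1) - 1)‖ =
    ‖padicEval₂ F ((1 + (p : ℚ_[p])) ^ (k - 2) - 1) ((1 + (p : ℚ_[p])) ^ (2 * a + 1 - 1) - 1)‖
  rw [heqs, heqj, hes, hej, hnAs, hnAj, hquot, map_div₀, norm_div]
  field_simp
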